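import Literature.AnabelianGeometry.EtaleTheta.FrobenioidThetaToyKummer

/-!
# [EtTh] §5, Lemma 5.8 / 5.9 (iv) at the Kummer toy: `Facts`, `InvariantUnitsEqConstants`, `IdentifiesPiY`, `CyclotomicCharacterCompat` HOLD JOINTLY with every binder live; `envIso` fires (pp. 331–332 / PDF pp. 105–106)

Mochizuki, *The étale theta function and its Frobenioid-theoretic manifestations*, Publ. RIMS **45** (2009),
Lemma 5.8 p.331 (PDF p.105): "`(O_K^×)^{1/N}` is equal to the set of elements of `O^×(B_N)` that normalize the subgroup
`E_N ⊆ Aut_C(B_N)`", proof: "the set of elements on which `Π^tp_Y` [i.e., `G_K`, via the natural surjection `Π^tp_Y ↠ G_K`]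
acts via multiplication by an element of `μ_N(B_N)` … is easily seen to coincide with `(O_K^×)^{1/N}`" [since `Y` is
geometrically connected over `K`]; Lemma 5.9 (iv) p.332 (PDF p.106) [cite: MochizukiEtTh2009, Lem 5.8 p.331 (PDF p.105)].
abc-iut cell, block F, seat abc-iut-f-120 (gen 2); FACT-LIST rows **F-0534** `ActsByCyclotome`, **F-0535**
`ConstantsActByCyclotome`, **F-0533** `IdentifiesPiY`, **F-1307** `CyclotomicCharacterCompat` (all `parametrised` schemata over
abstract §5 data; universal closures REFUTED in `FrobenioidMonoThetaSchemaNegative.lean`, p430951; instance forms in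
`Discharge/Sec5Lemma58ActsByCyclotome.lean`, p428744).  PROOF-ONLY companion (0 `def`, 0 instance, 0 `Prop` fact; nothing
landed is edited) of this seat's witness-data file `FrobenioidThetaToyKummer.lean` (the Kummer toy: `toy₄`, `env₄`,
`muEquiv₄`, `act₄`).

WHAT IS PROVED — at ONE closed §5/§2 datum whose units CARRY a Galois action (toy no. 4: `O^×(B_N) = O^×(B_N^birat) =
(μ₃ × ℤ) × ℚ^×`, `G_K = ℤ^×` inverting `μ₃ × ℤ` and fixing the constants `ℚ^×`, `Π^tp_Y̲ ↠ G_K` onto, `N = 3`, §2 character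
= the matching inversion):
* `invariantUnitsEqConstants_toy₄` — abc-iut-w4-d095's `InvariantUnitsEqConstants` ("`(O^×(B_N))^{Π^tp_Y} = O_K^×`", the
  geometric-connectedness input `hgc` of abc-iut-L2-t4's genuine-data route; GAP G-L2t4-4, reduced at the genuine data to a
  Galois-descent dictionary by abc-iut-L2-t11) HOLDS here, non-trivially: fixed by `−1` ⟺ the `μ₃ × ℤ`-part is `2`-torsion
  ⟺ it is trivial ⟺ the unit is a constant;
* `constantsActByCyclotome_toy₄` — hence **F-0535** through w4-d095's `constantsActByCyclotome_of_invariantUnitsEqConstants`,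
  and `constantsActByCyclotome_of_conjFixed_toy₄` — L2-t4's route `constantsActByCyclotome_of_conjFixed` (the shape of
  `…_ofModelData`) fires with its binder `hgc` DISCHARGED and L2-t11's `BiratAutAction` INHABITED (`act₄`);
* `facts_toy₄` — ALL EIGHT §5 named inputs of `ThetaFrobenioid.Facts`; `constantsEqNormalizer_toy₄` — Lemma 5.8 ITSELF;
* `identifiesPiY_toy₄` (**F-0533**), `identifiesPiYdd_toy₄` (F-0519), `cyclotomicCharacterCompat_toy₄` (**F-1307**, for
  `ι = id`, `m = muEquiv₄`, NON-TRIVIAL character), whence `nonempty_envIso_toy₄`: abc-iut-L2-t4's Lemma 5.9 (iv) isomorphism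
  `E^Π_N ⥲ Π^tp_Y[μ_N]` FIRES at a closed datum with every hypothesis a theorem;
* `actsByCyclotome_of_mem_OKxRootN_toy₄` — **F-0534**'s instance form (p428744) fires with the birational action inhabited;
* NON-DEGENERACY (every binder live, unlike toy no. 1–3 and abc-iut-f-115's `Sec5Toy.datum`): `μ_N(B_N) ⊊ (O_K^×)^{1/N} ⊊
  O^×(B_N)` (`exists_mem_OKxRootN_not_mem_muTorsion`, `exists_unit_not_mem_OKxRootN`), a unit NOT acted on via `μ_N(B_N)`
  and a non-torsion one that IS (`exists_unit_not_actsByCyclotome`, `exists_actsByCyclotome_not_mem_muTorsion`), the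
  cyclotome non-trivial and MOVED by `Π^tp_Y̲` (`zetaAut_ne_one`, `exists_PiY_moves_cyclotome`; the §2 character matches:
  `env₄_chi_ne_one`).
RELATION TO abc-iut-f-116's `Sec5DictionaryJointWitness.lean` (p436178, `Facts` + the Lemma 5.9 (iv) dictionary rows at toy no. 3
with the inversion character): there `O^×(B_N) = μ_3(B_N)`, so Lemma 5.8's dichotomy "acts via `μ_N(B_N)` ⟺ `N`-th root of a
constant" is automatic for every unit; toy no. 4 is the datum where it has content (F-0534 / F-0535), the rest is re-verified here
only because the joint statement needs it at the same datum.
HONEST FRAMING: a consistency / non-vacuity witness for OUR typed hypothesis lists and discharge routes; the toy is not the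
tempered Frobenioid of a Tate curve and says nothing about [EtTh] (a refereed paper) or [IUTchIII] Cor. 3.12; a FACT row is an
assumption label; typed ≠ proved; no side is taken.
-/

namespace Literature.AnabelianGeometry.EtaleTheta

open CategoryTheory
open Literature.AlgebraicGeometry.Frobenioids

namespace ThetaFrobenioid

namespace Toy

/-- `Aut_D(A_N^bs) ⥲ Aut_D(B_N^bs)` ("determined by `s^⊓_N, s^⊔_N`") is the identity in the toy: it is a
conjugation inside the ABELIAN group `Aut_D(⋆) = ℤ^×`.  [cite: MochizukiEtTh2009, §5 p.331 (PDF p.105)] -/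
theorem autBaseIsoAB_toy₄ (g : Aut (toy₄.base.obj toy₄.AN)) : toy₄.autBaseIsoAB g = g := by
  apply Aut.ext
  change (toy₄.baseIsoAB.conjAut g).hom = g.hom
  rw [Iso.conjAut_hom, Iso.conj_apply]
  -- in the one-object category of the abelian group `ℤ^×`, composition is multiplication
  have h : @HMul.hMul ℤˣ ℤˣ ℤˣ instHMul toy₄.baseIsoAB.hom toy₄.baseIsoAB.inv = 1 :=
    toy₄.baseIsoAB.inv_hom_id
  change @HMul.hMul ℤˣ ℤˣ ℤˣ instHMul (@HMul.hMul ℤˣ ℤˣ ℤˣ instHMul toy₄.baseIsoAB.hom g.hom)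
    toy₄.baseIsoAB.inv = g.hom
  rw [mul_right_comm, h, one_mul]

/-- … hence so is its inverse. [cite: MochizukiEtTh2009, §5 p.331 (PDF p.105)] -/
theorem autBaseIsoAB_symm_toy₄ (g : Aut (toy₄.base.obj toy₄.BN)) : toy₄.autBaseIsoAB.symm g = g :=
  (MulEquiv.symm_apply_eq _).mpr (autBaseIsoAB_toy₄ g).symm

/-- `μ₃ × ℤ` has no `2`-torsion: a Galois-moved unit fixed by the inversion is trivial. [folklore] -/
private theorem A₄_eq_one_of_inv_eq (a : A₄) (h : a⁻¹ = a) : a = 1 := by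
  have hn : a.1⁻¹ = a.1 := by rw [← Prod.fst_inv, h]
  have hz : a.2⁻¹ = a.2 := by rw [← Prod.snd_inv, h]
  refine Prod.ext ?_ ?_
  · have key : ∀ n : Multiplicative (ZMod 3), n⁻¹ = n → n = 1 := by decide
    exact key _ hn
  · have hz' := congrArg Multiplicative.toAdd hz
    rw [toAdd_inv] at hz'
    exact toAdd_eq_zero.mp (by omega)

/-! ### Lemma 5.8's arithmetic input HOLDS in the Kummer toy -/

/-- **abc-iut-w4-d095's `InvariantUnitsEqConstants` ("`(O^×(B_N))^{Π^tp_Y} = O_K^×`", the geometric-connectedness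
input `hgc` of Lemma 5.8's proof) HOLDS in the Kummer toy**: a unit `((n, z), q)` is fixed by `Π^tp_Y̲` — i.e. by
the inversion `−1 = par(y₄)` — iff `(n, z)` is `2`-torsion iff `(n, z) = 1` iff the unit is the constant `q`.
[cite: MochizukiEtTh2009, Lem 5.8 proof p.331 (PDF p.105)] -/
theorem invariantUnitsEqConstants_toy₄ : toy₄.InvariantUnitsEqConstants := by
  intro u
  constructor
  · intro h
    have h1 := SemidirectProduct.inl_injective
      ((homOf_conj_sgpCap_rho_toy₄ y₄ u).symm.trans (congrArg (homOf G₄ _) (h _ rho_y₄_mem_imPiY))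
        |>.trans (homOf_unit_toy₄ u))
    rw [par_y₄, invFstAction_apply] at h1
    have h2 : (ub u).1⁻¹ = (ub u).1 := by
      have := (Prod.ext_iff.mp h1).1; simpa using this
    exact ⟨(ub u).2, Prod.ext (A₄_eq_one_of_inv_eq _ h2).symm rfl⟩
  · rintro ⟨q, hq⟩ _ ⟨x, _, rfl⟩
    apply homOf_injective G₄ _
    have hb : ub u = ((1 : A₄), q) := hq.symm
    rw [homOf_conj_sgpCap_rho_toy₄, homOf_unit_toy₄, hb, invFstAction_apply]
    change SemidirectProduct.inl (((1 : A₄) ^ ((par x : ℤˣ) : ℤ), q) : B₄) = SemidirectProduct.inl ((1 : A₄), q)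
    rw [one_zpow]

/-- **Hence abc-iut-L2-t4's named arithmetic step `ConstantsActByCyclotome` (FACT-LIST F-0535) HOLDS in the Kummer
toy**, obtained — exactly as for the genuine data — through abc-iut-w4-d095's reduction
`constantsActByCyclotome_of_invariantUnitsEqConstants` (Kummer criterion + invariant units = constants).
[cite: MochizukiEtTh2009, Lem 5.8 proof p.331 (PDF p.105)] -/
theorem constantsActByCyclotome_toy₄ : toy₄.ConstantsActByCyclotome :=
  toy₄.constantsActByCyclotome_of_invariantUnitsEqConstants invariantUnitsEqConstants_toy₄

/-! ### The bundle `Facts` of §5 named inputs HOLDS in the Kummer toy -/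

/-- `s^⊔-gp_N = s^⊓-gp_N|_{H_{B_N}}` in the toy. [cite: MochizukiEtTh2009, §5 p.331 (PDF p.105)] -/
theorem sgpCup_toy₄ (h : toy₄.HB) : toy₄.sgpCup h = toy₄.sgpCap (h : Aut (toy₄.base.obj toy₄.BN)) := rfl

/-- **All eight of abc-iut-L2-t4's §5 named inputs (`ThetaFrobenioid.Facts`) HOLD in the Kummer toy**: the defining
relations of `s^⊓-gp_N, s^⊔-gp_N` (with `s^⊓_N = s^⊔_N = id`, `s^trv_N = s^⊓-gp_N`), the section property of
`s^trv_N = inr`, the (trivial) bi-Kummer difference cocycle, Aut-ampleness of `B_N` (`inr` splits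
`Aut_C(B_N) ↠ Aut_D(B_N^bs)`), Lemma 5.8's arithmetic step (`constantsActByCyclotome_toy₄`), and epimorphicity of
the identities.  [cite: MochizukiEtTh2009, §5 p.330–331 (PDF pp.104–105)] -/
theorem facts_toy₄ : toy₄.Facts where
  sgpCapSpec g := by
    change 𝟙 _ ≫ (toy₄.sgpCap g).hom = (toy₄.strv (toy₄.autBaseIsoAB.symm g)).hom ≫ 𝟙 _
    rw [Category.id_comp, Category.comp_id, autBaseIsoAB_symm_toy₄]
  sgpCupSpec h := by
    change 𝟙 _ ≫ (toy₄.sgpCup h).hom =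
      (toy₄.strv (toy₄.autBaseIsoAB.symm (h : Aut (toy₄.base.obj toy₄.BN)))).hom ≫ 𝟙 _
    rw [Category.id_comp, Category.comp_id, autBaseIsoAB_symm_toy₄, sgpCup_toy₄]
  strvSection g := by
    apply Aut.ext
    change π₄ (SemidirectProduct.inr ((autEquiv ℤˣ).symm g)) = g.hom
    rw [SemidirectProduct.rightHom_inr]
    exact (MulEquiv.symm_apply_eq _).mpr (Aut.ext rfl)
  biKummerDifferenceMem h := by
    rw [sgpCup_toy₄, mul_inv_cancel]
    exact (toy₄.muTorsion toy₄.BN toy₄.N).one_mem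
  autAmpleBN z := ⟨autEquiv G₄ (SemidirectProduct.inr (homOf ℤˣ (SingleObj.star ℤˣ) z)), by
    apply Aut.ext
    change π₄ (SemidirectProduct.inr (homOf ℤˣ (SingleObj.star ℤˣ) z)) = z.hom
    rw [SemidirectProduct.rightHom_inr]
    rfl⟩
  constantsActByCyclotome := constantsActByCyclotome_toy₄
  epi_sCap := show Epi (𝟙 _) from inferInstance
  epi_sCup := show Epi (𝟙 _) from inferInstance

/-- **Lemma 5.8 itself (`ConstantsEqNormalizer`: "`(O_K^×)^{1/N}` is equal to the set of elements of `O^×(B_N)` that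
normalize `E_N`") HOLDS in the Kummer toy**, by abc-iut-L2-t4's discharge `Facts.constantsEqNormalizer`.
[cite: MochizukiEtTh2009, Lem 5.8 p.331 (PDF p.105)] -/
theorem constantsEqNormalizer_toy₄ : toy₄.ConstantsEqNormalizer := facts_toy₄.constantsEqNormalizer

/-! ### Lemma 5.9 (iv): the dictionary hypotheses HOLD, with a non-trivial character; `envIso` fires -/

/-- **F-0533 (`IdentifiesPiY`) HOLDS** for the Kummer toy against the toy §2 datum under `ι = id`: both sides' `Π^tp_Y`
are `Ker(first coordinate)`.  [cite: MochizukiEtTh2009, Lem 5.9 (iv) p.332 (PDF p.106)] -/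
theorem identifiesPiY_toy₄ : toy₄.IdentifiesPiY env₄ (MulEquiv.refl _) := fun _ => Iff.rfl

/-- Also abc-iut-L2-t11's twin `IdentifiesPiYdd` (FACT-LIST F-0519): both sides' `Π^tp_Ÿ` coincide.
[cite: MochizukiEtTh2009, Lem 5.9 (iv) p.332 (PDF p.106)] -/
theorem identifiesPiYdd_toy₄ : toy₄.IdentifiesPiYdd env₄ (MulEquiv.refl _) := fun _ => Iff.rfl

/-- **F-1307 (`CyclotomicCharacterCompat`) HOLDS** for the Kummer toy, the toy §2 datum, `ι = id` and `m = muEquiv₄`, with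
a NON-TRIVIAL character: conjugation by `s^⊓-gp_N(ρ y)` on `μ_3(B_N) = μ₃ × 1 × 1` is the Galois action of
`par y ∈ G_K = ℤ^×`, i.e. `ζ ↦ ζ^{χ(aug y)}` — "`Π^tp_Y` [i.e., `G_K` …] acts via multiplication by [the character]".
[cite: MochizukiEtTh2009, Lem 5.8 proof p.331 (PDF p.105)] -/
theorem cyclotomicCharacterCompat_toy₄ : toy₄.CyclotomicCharacterCompat env₄ (MulEquiv.refl _) muEquiv₄ := by
  intro y _ u u' hu'
  have key : ubμ u' = φ₄ (par y) (ubμ u) := by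
    apply SemidirectProduct.inl_injective (N := B₄) (G := ℤˣ) (φ := φ₄)
    have h1 := homOf_unit_toy₄ (Subgroup.inclusion (toy₄.muTorsion_le_units toy₄.BN toy₄.N) u')
    have h2 := homOf_conj_sgpCap_rho_toy₄ y (Subgroup.inclusion (toy₄.muTorsion_le_units toy₄.BN toy₄.N) u)
    rw [← h1, ← h2]
    exact congrArg (homOf G₄ _) hu'
  change (ubμ u').1.1 = (ubμ u).1.1 ^ ((par y : ℤˣ) : ℤ)
  exact congrArg (fun b : B₄ => b.1.1) key

/-- **abc-iut-L2-t4's Lemma 5.9 (iv) group isomorphism `E^Π_N ⥲ Π^tp_Y[μ_N]` (`envIso`) FIRES at the Kummer toy** — all of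
its hypotheses (`Facts`, `IdentifiesPiY`, `CyclotomicCharacterCompat`) being theorems here, with `μ_N`, the character and
the `Π^tp_Y̲`-action non-trivial.  [cite: MochizukiEtTh2009, Lem 5.9 (iv) p.332 (PDF p.106)] -/
theorem nonempty_envIso_toy₄ : Nonempty (toy₄.EPiN ≃* env₄.env) :=
  ⟨toy₄.envIso facts_toy₄ env₄ (MulEquiv.refl _) muEquiv₄ identifiesPiY_toy₄ cyclotomicCharacterCompat_toy₄⟩

/-! ### The instance forms of `Discharge/Sec5Lemma58ActsByCyclotome.lean` and abc-iut-L2-t4's genuine-data route fire -/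

/-- **F-0534's instance form fires**: with the birational action INHABITED (`act₄`), every element of `(O_K^×)^{1/N}` of
the toy acts via `μ_N(B_N)` by `actsByCyclotome_of_mem_OKxRootN` (birational action alone).
[cite: MochizukiEtTh2009, Lem 5.8 proof p.331 (PDF p.105)] -/
theorem actsByCyclotome_of_mem_OKxRootN_toy₄ {u : Aut toy₄.BN} (hu : u ∈ toy₄.OKxRootN) :
    toy₄.ActsByCyclotome u :=
  toy₄.actsByCyclotome_of_mem_OKxRootN act₄ hu

/-- **abc-iut-L2-t4's genuine-data route `constantsActByCyclotome_of_conjFixed` (the shape of `…_ofModelData`) fires at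
the toy with its geometric-connectedness binder `hgc` DISCHARGED** (`invariantUnitsEqConstants_toy₄`, forward half).
[cite: MochizukiEtTh2009, Lem 5.8 proof p.331 (PDF p.105)] -/
theorem constantsActByCyclotome_of_conjFixed_toy₄ : toy₄.ConstantsActByCyclotome :=
  toy₄.constantsActByCyclotome_of_conjFixed act₄ fun u h => (invariantUnitsEqConstants_toy₄ u).mp h

/-! ### Every binder is live: the toy is non-degenerate -/

/-- `ζ := inl((1 mod 3, 0), 1) ∈ μ_3(B_N)` is a NON-TRIVIAL element of the cyclotome.
[cite: MochizukiEtTh2009, Def 5.4 p.327 (PDF p.101)] -/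
theorem zetaAut_ne_one : zetaAut (Multiplicative.ofAdd 1) ≠ 1 := by
  intro h
  have h1 : Multiplicative.ofAdd (1 : ZMod 3) = (homOf G₄ (SingleObj.star G₄) (1 : Aut toy₄.BN)).left.1.1 := by
    rw [← h]; rfl
  rw [MonoidHom.map_one] at h1
  exact absurd h1 (by decide)

/-- **`Π^tp_Y̲` MOVES the cyclotome** (the feature by which toy no. 3 refuted F-1307 against a TRIVIAL character; here the
character of `env₄` matches): `s^⊓-gp_N(ρ y₄)` conjugates `ζ` to `ζ⁻¹ ≠ ζ`.
[cite: MochizukiEtTh2009, Lem 5.8 proof p.331 (PDF p.105)] -/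
theorem exists_PiY_moves_cyclotome : ∃ y ∈ toy₄.PiY, ∃ u ∈ toy₄.muTorsion toy₄.BN toy₄.N,
    toy₄.sgpCap (toy₄.ρ y) * u * (toy₄.sgpCap (toy₄.ρ y))⁻¹ ≠ u := by
  refine ⟨y₄, y₄_mem_ker, zetaAut (Multiplicative.ofAdd 1), zetaAut_mem _, fun h => ?_⟩
  have h1 := congrArg (homOf G₄ _) h
  rw [homOf_conj_sgpCap_rho_toy₄ y₄ ⟨_, autEquiv_inl_mem_units _⟩, ub_autEquiv_inl, homOf_autEquiv,
    SemidirectProduct.inl_inj, par_y₄, invFstAction_apply] at h1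
  have h2 := congrArg (fun b : B₄ => b.1.1) h1
  simp only [Units.val_neg, Units.val_one, zpow_neg, zpow_one] at h2
  exact absurd h2 (by decide)

/-- **`μ_N(B_N) ⊊ (O_K^×)^{1/N}`**: the constant unit `−1 = inl((0, 0), −1)` lies in `(O_K^×)^{1/N}` (its cube `−1` is a
constant) but not in `μ_3(B_N)`.  [cite: MochizukiEtTh2009, Lem 5.8 p.331 (PDF p.105)] -/
theorem exists_mem_OKxRootN_not_mem_muTorsion :
    ∃ u ∈ toy₄.OKxRootN, u ∉ toy₄.muTorsion toy₄.BN toy₄.N := by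
  refine ⟨autEquiv G₄ (SemidirectProduct.inl (((1 : A₄), (-1 : ℚˣ)) : B₄)), ?_, ?_⟩
  · refine (mem_OKxRootN_iff _).mpr ⟨autEquiv_inl_mem_units _, -1, ?_⟩
    change ((1 : A₄), (-1 : ℚˣ)) = (((1 : A₄), (-1 : ℚˣ)) : B₄) ^ (3 : ℕ)
    rw [Prod.pow_mk, one_pow, Odd.neg_one_pow (⟨1, rfl⟩ : Odd 3)]
  · rintro ⟨-, hpow⟩
    rw [autEquiv_inl_pow] at hpow
    have h1 := congrArg (fun a : Aut toy₄.BN => (homOf G₄ _ a).left.2) hpow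
    simp only [homOf_autEquiv, SemidirectProduct.left_inl, Prod.pow_snd, MonoidHom.map_one,
      SemidirectProduct.one_left, Prod.snd_one, PNat.val_ofNat] at h1
    rw [Odd.neg_one_pow (⟨1, rfl⟩ : Odd 3)] at h1
    exact absurd (congrArg Units.val h1) (by norm_num)

/-- **`(O_K^×)^{1/N} ⊊ O^×(B_N)`**: the unit of infinite order `inl((0, 1), 1)` is NOT in `(O_K^×)^{1/N}` (its cube
`(0, 3, 1)` is not a constant).  [cite: MochizukiEtTh2009, Lem 5.8 p.331 (PDF p.105)] -/
theorem exists_unit_not_mem_OKxRootN : ∃ u ∈ toy₄.units toy₄.BN, u ∉ toy₄.OKxRootN := by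
  refine ⟨autEquiv G₄ (SemidirectProduct.inl ((((1 : Multiplicative (ZMod 3)), Multiplicative.ofAdd (1 : ℤ)),
    (1 : ℚˣ)) : B₄)), autEquiv_inl_mem_units _, fun h => ?_⟩
  obtain ⟨_, k, hk⟩ := (mem_OKxRootN_iff _).mp h
  have h1 := congrArg (fun b : B₄ => Multiplicative.toAdd b.1.2) hk
  change Multiplicative.toAdd (1 : Multiplicative ℤ) =
    Multiplicative.toAdd (((((1 : Multiplicative (ZMod 3)), Multiplicative.ofAdd (1 : ℤ)), (1 : ℚˣ)) : B₄) ^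
      (3 : ℕ)).1.2 at h1
  simp only [Prod.pow_fst, Prod.pow_snd, toAdd_one, toAdd_pow, toAdd_ofAdd] at h1
  exact absurd h1 (by decide)

/-- **Hence a unit on which `Π^tp_Y̲` does NOT act via `μ_N(B_N)`** (by `ConstantsActByCyclotome`, proved above): F-0534's
predicate is a genuine condition in the toy, as in print.  [cite: MochizukiEtTh2009, Lem 5.8 proof p.331 (PDF p.105)] -/
theorem exists_unit_not_actsByCyclotome : ∃ u ∈ toy₄.units toy₄.BN, ¬ toy₄.ActsByCyclotome u := by
  obtain ⟨u, hu, hn⟩ := exists_unit_not_mem_OKxRootN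
  exact ⟨u, hu, fun ha => hn ((constantsActByCyclotome_toy₄ u).mpr ⟨hu, ha⟩)⟩

/-- … and a unit outside `μ_N(B_N)` on which it DOES (the constant `−1`).
[cite: MochizukiEtTh2009, Lem 5.8 proof p.331 (PDF p.105)] -/
theorem exists_actsByCyclotome_not_mem_muTorsion :
    ∃ u ∈ toy₄.units toy₄.BN, toy₄.ActsByCyclotome u ∧ u ∉ toy₄.muTorsion toy₄.BN toy₄.N := by
  obtain ⟨u, hu, hn⟩ := exists_mem_OKxRootN_not_mem_muTorsion
  exact ⟨u, toy₄.OKxRootN_le_units hu, actsByCyclotome_of_mem_OKxRootN_toy₄ hu, hn⟩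

/-! ### Neighbouring §5 rows at the same non-degenerate datum (by abc-iut-L2-t4's consequences of `Facts`) -/

/-- F-0738 `SgpCapSection` (`(s^⊓-gp_N(g))^bs = g`) at the Kummer toy. [cite: MochizukiEtTh2009, §5 p.331 (PDF p.105)] -/
theorem sgpCapSection_toy₄ : toy₄.SgpCapSection := facts_toy₄.sgpCapSection

/-- F-0543 `SgpCupSection` at the Kummer toy. [cite: MochizukiEtTh2009, §5 p.331 (PDF p.105)] -/
theorem sgpCupSection_toy₄ : toy₄.SgpCupSection := facts_toy₄.sgpCupSection

/-- F-0554 `SgpUnique` (uniqueness of `(s^⊓-gp_N, s^⊔-gp_N)`) at the Kummer toy. [cite: MochizukiEtTh2009, §5 p.331 (PDF p.105)] -/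
theorem sgpUnique_toy₄ : toy₄.SgpUnique := facts_toy₄.sgpUnique

/-- F-0737 `AutAmpleBN` at the Kummer toy — with NON-TRIVIAL `Aut_D(B_N^bs) = ℤ^×` (the section `inr` splits
`Aut_C(B_N) ↠ Aut_D(B_N^bs)`).  [cite: MochizukiEtTh2009, §5 p.330 (PDF p.104)] -/
theorem autAmpleBN_toy₄ : toy₄.AutAmpleBN := facts_toy₄.autAmpleBN

/-- F-0542 `SectionsFactor` (Lemma 5.9 (i)) at the Kummer toy. [cite: MochizukiEtTh2009, Lem 5.9 (i) p.331 (PDF p.105)] -/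
theorem sectionsFactor_toy₄ : toy₄.SectionsFactor := facts_toy₄.sectionsFactor

/-- F-0537 `ENExact` (Lemma 5.9 (ii): `1 → μ_N(B_N) → E_N → Im(Π^tp_Y) → 1`) at the Kummer toy, where all three groups are
non-trivial (`μ_N(B_N) = μ₃`, `Im(Π^tp_Y̲) = ℤ^×`).  [cite: MochizukiEtTh2009, Lem 5.9 (ii) p.332 (PDF p.106)] -/
theorem enExact_toy₄ : toy₄.ENExact := facts_toy₄.enExact

end Toy

end ThetaFrobenioid

end Literature.AnabelianGeometry.EtaleTheta
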